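import Literature.NumberTheory.EllipticCurves.LambdaInvariantCongruenceTransportAtTwo
import Literature.NumberTheory.EllipticCurves.Sprung2017.SharpFlatPAdicLFunction
import Literature.NumberTheory.EllipticCurves.CuspFormLFunction
import Literature.NumberTheory.EllipticCurves.Rank1Residual.Predicates
import Literature.NumberTheory.EllipticCurves.Kobayashi2003.SignedSelmer
import Literature.NumberTheory.EllipticCurves.PAdicLFunction
import Literature.NumberTheory.EllipticCurves.PAdicLFunctionMinus
import HarnessLib

/-!
# Cell `bsd-f1-sign2` (`p = 2`, non-CM) — 2-descent / real-place lens (seat `-desc`) g1: the PENCIL TRANSPORT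
# at `2` typed at symbol level (candidates DESC-C `PencilTransportAtTwo`, D `ShadowMuZeroAtTwo`,
# E `ThreeLineLayerLawAtTwo`, supports S1 `SymbolTwoIntegralityAtTwo`, S2 `PencilLemma` (PROVED), B′
# `IsoscelesLawSignedSelmerAtTwoFG`) with the proved glue of Sketch v1.3

HONEST FRAMING (typer seat `bsd-f1-sign2-ty`; HOME `run/shared/lean/pub/bsd-f1-sign2/`, CANDIDATES.md §2
rows DESC-C/D/E/S1/S2/B′ (C′ dropped, see REFUTER PASS); the -desc ask of MEMO-desc §9.6: «ONE statement file
`F1Sign2/PencilTransportAtTwo.lean` from Sketch-v1.2»): STATEMENTS ONLY — carriers = definitions with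
bodies over tree symbols (`IsRealTwoDivRoot`, `IsLeastRealTwoDivRoot`, `IsLargest…`, `IsMiddle…`,
`IsRootMap`, `IsBlockRoot`, `IsIsosceles`, `depleteSymbolAt/Over`, `IsTwoIntegral`, `twoParity`,
`plusShadow`, `minusShadow`, `lineShadow`, `shadowLayer`, `layerOrder`, `IsIsoscelesTop`), five
`@[conjecture] def`s (OPEN obligations of ours: DESC-C THE CRUX, expected grade IN-PRINT-ASSEMBLY at 2 per
the planner and REF2 v3; D conjectural `μ = 0` of the `E[2]`-valued element (REF2 v3: open core (β));
E target; S1 support elementary; S2 `PencilLemma` — PROVED in the sibling proof file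
`F1Sign2/PencilTransportAtTwoProofs.lean` (`pencilLemma : PencilLemma`, with `threeLineLayerLaw_of_pencilTransport :
PencilTransportAtTwo → ThreeLineLayerLawAtTwo` = «DESC-E is DESC-C + algebra» and
`hasRationalTwoTorsionX_of_isRealTwoDivRoot`; split off because Theorems-side files with proofs are ≤ 400
lines); B′ algebraic rung with REF1's `(H_fin)` explicit);
nothing asserted, nothing booked, no named fact, PARTITION: none moved. Source:
`HOME/MEMO-desc-data/Sketch-v1.3.lean` sha16 82f53a80310d89d4 (= v1.2 adfc100f063aa655 statements
byte-identical + 4 theorems; planner bsd-f1-sign2-desc g1; `lean check` rc 0, 0 warnings, 0 sorries),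
re-filed VERBATIM (namespace moved from `…BirchSwinnertonDyer.F1Sign2Desc` to the cell's
`…Rank1Residual.F1Sign2`; `@[conjecture]` tags added on the closed unproved Props) MINUS the three decls
REF1 batch 3 told the typer not to file as is: `PencilTransportAtTwoOddLevel` (C′ — **KILLED,
refuted-misstated**: a constant root map onto a rational 2-torsion abscissa of `W₂`; repair = add
`∀ t : ℚ, ¬ IsRealTwoDivRoot W₂ t`, left to the planner), `OddLevelTransportImpliesSS` (MOOT: true ex
falso) and its glue `oddLevelTransportImpliesSS_of` (REF1-AUDIT-v1 §9.3/§9.6, 2026-08-27T15:41Z: the other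
six decls + three proofs «clear to file»; CRUX `PencilTransportAtTwo` **SURVIVES**, `PencilLemma` PROVED,
`SymbolTwoIntegralityAtTwo` / `ShadowMuZeroAtTwo` / `ThreeLineLayerLawAtTwo` / `IsoscelesLawSignedSelmerAtTwoFG`
SURVIVE). REF2-PLACEMENT-v3 §0: DESC-C IN-PRINT-ASSEMBLY at 2, new as STATEMENT; DESC-D OPEN-IN-PRINT family,
E[2]-valued phrasing NOVEL-AS-STATED; DESC-E = C + PencilLemma; S1 IN-PRINT-ASSEMBLY; B′ NOVEL-AS-STATED over
P-ODD-ONLY objects ⇒ OPEN. Earlier: v1.0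
(Sketch f4b576fcc8676a96) REF1-AUDIT-v1 §4 — `IsoscelesLawAtTwo` SURVIVES with two statement gaps
(own-`tᵢ` normalisation; hidden no-finite-submodule hypothesis in DESC-B) which v1.1 ANSWERS (no `tᵢ`, no
Sprung pair; `(H_fin)` explicit); REF2 v2 §0: DESC-A/B NOVEL-AS-STATED.

BC5 WITNESS (MEMO-desc §9.3; MEMO-desc-data/transport_test.py 39948b1c4707c927 → transport_out.txt
4470ab647ca9bef1, transport_pairs.tsv ba9481dff2914008, .json 6d3bf9b4688fa62a; inputs ENGINE D2
j280798 + j281647 exact symbols; 725 records → 153 `Δ>0` S₃ curves; 36 same-2-division-field pairs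
certified by resultant cubic factor): **habitat (ss/ss, odd N) 23/23 pairs FULL, 69/69 lines,
4 278/4 278 values** (m = 2..6, all odd a), control undepleted 66/69 (depletion load-bearing on
557b1~13925d1), permutations realised identity 8 / least↔middle 14 / 3-cycle 1 (37b1→37a1); off habitat
(2∥N) 12/13 FULL, the unique MISMATCH 14882e1~14882f1 = the unique pair with `E[2] ⊂ E(ℚ₂)` (scalar
`Frob₂` = Buzzard Thm 6.1's excluded case); single-curve: 2-integrality m ≤ 9 153/153, `μ = 0` undepleted
153/153. CHEAPEST FALSIFIER: a same-field pair of `Δ>0` good-at-2 S₃ curves with one depleted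
line-shadow disagreement → **0/4 278: NOT KILLED**. WHY NOVEL (MEMO-desc §9.4): the p-odd
canonical-periods transport (Vatsal 1999 / Greenberg–Vatsal 2000 / EPW 2006) needs ± parts; at `2` with
`Δ > 0` the receptacle is `E[2]` itself; mult-one input = Buzzard Thm 6.1
[corpus:book:conradnd-arithmetic-algebraic-geometry p0203]; honest grade DESC-C = IN-PRINT-ASSEMBLY at 2
expected (6-step sketch + gaps G-a..G-d), new as STATEMENT; open content = DESC-D, DESC-B′, bridge
shadows ↔ λ♯/♭ ↔ BSD₂.

References: [MazurTateTeitelbaum1986Invent] §I.8; [Kobayashi2003] (signed Selmer dual data, p odd in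
print); HOME MEMO-desc.md §9 (file sha16 0b41c33577ce6ee4), MEMO-desc-data/Sketch-v1.3.lean,
REF1-AUDIT-v1.md §§4, 8.4, REF2-PLACEMENT-v2.md §4.

## The planner's sketch docstring (v1.3, verbatim)
# Sketch v1.3 — cell `bsd-f1-sign2`, seat `-desc` g1: the PENCIL TRANSPORT crux typed at symbol level (v1.2 statements byte-identical + four PROVED glue theorems)

v1.0 (g0, sha16 f4b576fcc8676a96) typed the three-line / isosceles law over Sprung pairs
(`IsoscelesLawAtTwo`), its signed-Selmer twin and the baseline `NoRationalTwoTorsionOfSupersingularTwo`.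
REF1 (REF1-AUDIT-v1 §4) located the one OPEN mechanism behind all of it: the transport identity
`θ̄(Eᵢ) = e₂(Ξ, Tᵢ)` — "everything after is forced algebra" — and flagged two statement gaps
(own-`tᵢ` normalisation in DESC-A; hidden no-finite-submodule hypothesis in DESC-B).

v1.1 types that mechanism WITHOUT any new `E[2]`-valued carrier, over existing tree symbols:
for `Δ_E > 0` the period lattice `Λ_f = ℤω₁ ⊕ ℤω₂` of the newform is rectangular, the tree
normalisation is `re Λ_f = ℤ·Ω⁺_f/2`, `im Λ_f = ℤ·Ω⁻_f/2` (`ModularSymbols.lean`), hence for a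
`2`-integral lattice-valued symbol `ξ(r) = m⁺ω₁ + m⁻ω₂` one has `2[r]⁺_f = m⁺`, `2[r]⁻_f = m⁻`:
the PARITIES of `2·ratPlusSymbol`, `2·ratMinusSymbol` are the two coordinates of
`ξ̄(r) ∈ Λ_f/2Λ_f ≅ E_f[2]`, and by the Weil pairing (`e₂(ω₁/2, ω₂/2) = 1`, alternating)
  `m⁺ = e₂(ξ̄, T_least)` (`T_least = ω₂/2`, abscissa the LEAST root `e₃`, the Kummer line `C_∞[2]`),
  `m⁻ = e₂(ξ̄, T_largest)` (`ω₁/2`, identity component, LARGEST root `e₁`),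
  `m⁺ + m⁻ = e₂(ξ̄, T_middle)` (`(ω₁+ω₂)/2`).
So the three "line shadows" of the `E[2]`-valued depleted Mazur–Tate element are the mod-2
plus symbol, the mod-2 minus symbol and their sum; the transport crux says a mod-2 congruence
(`G_ℚ`-isomorphism `E₁[2] ≅ E₂[2]`, read on abscissae as a rational ROOT MAP) carries line shadows to
line shadows. New items: `SymbolTwoIntegralityAtTwo` (support, elementary), `ShadowMuZeroAtTwo`
(support, conjectural `μ = 0`), `PencilTransportAtTwo` (THE CRUX), `PencilTransportAtTwoOddLevel` (v1.2: natural habitat, data-validated), `ThreeLineLayerLawAtTwo`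
(target: forced by the crux + the pencil lemma over `𝔽₂[T]`), `IsoscelesLawSignedSelmerAtTwoFG`
(DESC-B with REF1's `(H_fin)` explicit). g0's defs are kept verbatim so the file is self-contained.
v1.3 (appended, statements above unchanged) PROVES: `pencilLemma : PencilLemma`;
`threeLineLayerLaw_of_pencilTransport : PencilTransportAtTwo → ThreeLineLayerLawAtTwo` (DESC-E is
DESC-C plus algebra: a real cubic has ≤ 3 roots, `shadowLayer` is additive, pencil lemma);
`hasRationalTwoTorsionX_of_isRealTwoDivRoot` (a rational root of the `2`-division cubic is the abscissa
of a rational `2`-torsion point, tree predicate `Greenberg1999.HasRationalTwoTorsionX`);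
`oddLevelTransportImpliesSS_of : (REF1-AUDIT §8.4 lemma) → OddLevelTransportImpliesSS`.
No Prop is asserted; `lean check` rc 0, 0 sorries.
-/

set_option autoImplicit false

noncomputable section

open scoped Classical MatrixGroups ModularForm
open CongruenceSubgroup WeierstrassCurve PowerSeries
open Literature.NumberTheory.EllipticCurves Literature.NumberTheory.EllipticCurves.ModularForms
  Literature.NumberTheory.EllipticCurves.Sprung2017 Literature.NumberTheory.EllipticCurves.Rank1Residual

namespace Summit.BirchSwinnertonDyer.Rank1Residual.F1Sign2

/-! ## v1.0 carriers (g0, verbatim) -/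

/-- `θ : ℝ` is a real root of the `2`-division polynomial `ψ_W = 4x³ + b₂x² + 2b₄x + b₆`. -/
def IsRealTwoDivRoot (W : WeierstrassCurve ℚ) (θ : ℝ) : Prop :=
  4 * θ ^ 3 + (W.b₂ : ℝ) * θ ^ 2 + 2 * (W.b₄ : ℝ) * θ + (W.b₆ : ℝ) = 0

/-- `θ` is the LEAST real root of `ψ_W` (for `Δ_W > 0`: the abscissa of the generator of
`C_{W,∞}[2]`, Greenberg LNM 1716 §5). -/
def IsLeastRealTwoDivRoot (W : WeierstrassCurve ℚ) (θ : ℝ) : Prop :=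
  IsRealTwoDivRoot W θ ∧ ∀ r : ℝ, IsRealTwoDivRoot W r → θ ≤ r

/-- The rational ROOT MAP `q = (q₀,q₁,q₂)`: `ψ_W(θ) = 0 ⇒ ψ_{W′}(q₀ + q₁θ + q₂θ²) = 0` over `ℂ` — a
`G_ℚ`-equivariant map `E[2] ∖ 0 → E′[2] ∖ 0` on abscissae (a bijection as soon as `ψ_{W′}` is
irreducible; unique when `ℚ(E[2])` is an `S₃`-field). -/
def IsRootMap (W W' : WeierstrassCurve ℚ) (q₀ q₁ q₂ : ℚ) : Prop :=
  ∀ θ : ℂ, 4 * θ ^ 3 + (W.b₂ : ℂ) * θ ^ 2 + 2 * (W.b₄ : ℂ) * θ + (W.b₆ : ℂ) = 0 →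
    4 * ((q₀ : ℂ) + q₁ * θ + q₂ * θ ^ 2) ^ 3 + (W'.b₂ : ℂ) * ((q₀ : ℂ) + q₁ * θ + q₂ * θ ^ 2) ^ 2 +
      2 * (W'.b₄ : ℂ) * ((q₀ : ℂ) + q₁ * θ + q₂ * θ ^ 2) + (W'.b₆ : ℂ) = 0

/-- The BLOCK ROOT of `W′` in `W`'s frame: the real root `θ` of `ψ_W` that the root map sends to the
least real root of `ψ_{W′}`. -/
def IsBlockRoot (W W' : WeierstrassCurve ℚ) (q₀ q₁ q₂ : ℚ) (θ : ℝ) : Prop :=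
  IsRealTwoDivRoot W θ ∧ IsLeastRealTwoDivRoot W' ((q₀ : ℝ) + q₁ * θ + q₂ * θ ^ 2)

/-- ISOSCELES SHAPE of three naturals: two are equal and the third is STRICTLY larger. -/
def IsIsosceles (P₁ P₂ P₃ : ℕ) : Prop :=
  (P₁ = P₂ ∧ P₁ < P₃) ∨ (P₁ = P₃ ∧ P₁ < P₂) ∨ (P₂ = P₃ ∧ P₂ < P₁)

/-! ## v1.1 carriers: the other two real lines, symbol-level depletion, mod-2 shadows -/

/-- `θ` is the LARGEST real root of `ψ_W` (for `Δ_W > 0`: abscissa of the point of order two on the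
identity component `E⁰(ℝ)`, i.e. of `ω₁/2`). -/
def IsLargestRealTwoDivRoot (W : WeierstrassCurve ℚ) (θ : ℝ) : Prop :=
  IsRealTwoDivRoot W θ ∧ ∀ r : ℝ, IsRealTwoDivRoot W r → r ≤ θ

/-- `θ` is the MIDDLE real root of `ψ_W` (exists iff `Δ_W > 0`; abscissa of `(ω₁+ω₂)/2`). -/
def IsMiddleRealTwoDivRoot (W : WeierstrassCurve ℚ) (θ : ℝ) : Prop :=
  IsRealTwoDivRoot W θ ∧ (∃ r : ℝ, IsRealTwoDivRoot W r ∧ r < θ) ∧ (∃ r : ℝ, IsRealTwoDivRoot W r ∧ θ < r)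

/-- SYMBOL-LEVEL DEPLETION AT ONE PRIME `ℓ`: the symbol of the `ℓ`-depleted form
`g^{[ℓ]} = g − a_ℓ·g|V_ℓ + ℓ·g|V_ℓ²` (good `ℓ`), `g − a_ℓ·g|V_ℓ` (multiplicative `ℓ`), `g` (additive `ℓ`),
using `{∞, r}_{g(ℓz)} = ℓ⁻¹{∞, ℓr}_g`: `r ↦ g(r) − (a_ℓ/ℓ)·g(ℓr) + (1/ℓ)·g(ℓ²r)` etc. The reduction type
is read off `ord_ℓ(N_W)` as in `matsunoLocalTermAtTwo`, and `a_ℓ = W.LFunction ℓ` (Mathlib). This is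
multiplication of the Mazur–Tate element by the Euler factor `P_ℓ(ℓ⁻¹σ_ℓ⁻¹)` — orientation-free,
because it is the symbol of an actual form (answers trap T15 of REF1-CARRIERS-AT2-v1). -/
def depleteSymbolAt (W : WeierstrassCurve ℚ) (ℓ : ℕ) (g : ℚ → ℚ) : ℚ → ℚ :=
  if (W.conductorNorm ℤ).factorization ℓ = 0 then
    fun r => g r - (W.LFunction ℓ : ℚ) / ℓ * g (ℓ * r) + 1 / (ℓ : ℚ) * g ((ℓ : ℚ) ^ 2 * r)
  else if (W.conductorNorm ℤ).factorization ℓ = 1 then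
    fun r => g r - (W.LFunction ℓ : ℚ) / ℓ * g (ℓ * r)
  else g

/-- DEPLETION OVER A FINITE SET `S` of primes (the prime `2` is never depleted): iterate
`depleteSymbolAt` over `S ∖ {2}` in increasing order (the one-prime operators commute). -/
def depleteSymbolOver (W : WeierstrassCurve ℚ) (S : Finset ℕ) (g : ℚ → ℚ) : ℚ → ℚ :=
  ((S.filter (· ≠ 2)).sort (· ≤ ·)).foldr (depleteSymbolAt W) g

/-- `x ∈ ℚ` is `2`-integral (odd reduced denominator). -/
def IsTwoIntegral (x : ℚ) : Prop := Odd x.den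

/-- The PARITY of a `2`-integral rational: its reduced numerator mod `2` (junk when `x.den` is even). -/
def twoParity (x : ℚ) : ZMod 2 := (x.num : ZMod 2)

variable {N : ℕ}

/-- PLUS SHADOW `e₂(Ξ^S(r), T_least) = 2·[r]⁺_{f,S} mod 2` — parity of twice the `S`-depleted rational
plus symbol (`re Λ_f = ℤ·Ω⁺_f/2`, so `2[r]⁺` is the `ω₁`-coordinate of the lattice-valued symbol). -/
def plusShadow (W : WeierstrassCurve ℚ) (f : CuspForm (Gamma0 N) 2) (S : Finset ℕ) (r : ℚ) : ZMod 2 :=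
  twoParity (2 * depleteSymbolOver W S (ratPlusSymbol f) r)

/-- MINUS SHADOW `e₂(Ξ^S(r), T_largest) = 2·[r]⁻_{f,S} mod 2` (`im Λ_f = ℤ·Ω⁻_f/2`: the
`ω₂`-coordinate). Along `r = 5^k/2^{n+2}` these are the coefficients of the `χ₄`-branch (odd-branch)
layer element. -/
def minusShadow (W : WeierstrassCurve ℚ) (f : CuspForm (Gamma0 N) 2) (S : Finset ℕ) (r : ℚ) : ZMod 2 :=
  twoParity (2 * depleteSymbolOver W S (ratMinusSymbol f) r)

/-- LINE SHADOW `e₂(Ξ^S(r), T_θ)` on the real line with abscissa `θ`: least root ↦ plus shadow,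
largest root ↦ minus shadow, middle root ↦ their sum (the Weil-pairing dictionary of the header;
for `Δ_W > 0` the three cases are exclusive and exhaustive). -/
def lineShadow (W : WeierstrassCurve ℚ) (f : CuspForm (Gamma0 N) 2) (S : Finset ℕ) (r : ℚ) (θ : ℝ) :
    ZMod 2 :=
  if IsLeastRealTwoDivRoot W θ then plusShadow W f S r
  else if IsLargestRealTwoDivRoot W θ then minusShadow W f S r
  else plusShadow W f S r + minusShadow W f S r

/-- LAYER-`n` ELEMENT of a shadow `c` along the cyclotomic `ℤ₂`-tower:
`S_n(c) = Σ_{k < 2^n} c(5^k/2^{n+2})·(1+T)^k ∈ 𝔽₂[T]` (canonical representative of degree `< 2^n`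
of the class mod `(1+T)^{2^n} − 1 = T^{2^n}`; `γ = σ₅ ↦ 1+T`). -/
def shadowLayer (c : ℚ → ZMod 2) (n : ℕ) : Polynomial (ZMod 2) :=
  ∑ k ∈ Finset.range (2 ^ n), Polynomial.C (c ((5 : ℚ) ^ k / 2 ^ (n + 2))) * (Polynomial.X + 1) ^ k

/-- `λ`-SHAPE of a layer element: its `T`-adic order in `ℕ∞` (`⊤` for the zero element, i.e. `μ ≥ 1`
at this layer). -/
def layerOrder (c : ℚ → ZMod 2) (n : ℕ) : ℕ∞ :=
  (shadowLayer c n).trailingDegree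

/-- ISOSCELES-OR-DEGENERATE shape in `ℕ∞`: two equal and the third strictly larger (this includes
"two tied finite, third `⊤`"), or all three `⊤`. Over `𝔽₂` a pencil `{A, B, A+B}` always has this
shape (ultrametric + `1+1 = 0` kills the equilateral case). -/
def IsIsoscelesTop (t₁ t₂ t₃ : ℕ∞) : Prop :=
  (t₁ = t₂ ∧ t₁ < t₃) ∨ (t₁ = t₃ ∧ t₁ < t₂) ∨ (t₂ = t₃ ∧ t₂ < t₁) ∨ (t₁ = ⊤ ∧ t₂ = ⊤ ∧ t₃ = ⊤)

/-! ## v1.1 statements -/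

/-- **Support (elementary, provable) — `2`-INTEGRALITY OF THE DOUBLED SYMBOLS AT `2`-POWER CUSPS.**
`W` globally minimal elliptic, good supersingular at `2`, `f` its newform, `S` a finite set of odd
primes: `2·[a/2^m]^{±}_{f,S}` are `2`-integral. Reason: `2 ∤ N`, so the cusp `a/2^m` is
`Γ₀(N)`-equivalent to `0`, `{0, a/2^m} ∈ H₁(X₀(N), ℤ) ↦ Λ_f`, and `{∞,0} ↦` a lift of the rational
torsion point `π_f(0) ∈ E_f(ℚ)`, of ODD order because `E_f(ℚ)[2] = 0` at a supersingular `2`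
(`NoRationalTwoTorsionOfSupersingularTwo`, isogeny-invariant); depletion adds `ℤ[1/ℓ]`-combinations,
`ℓ` odd. Resolves gap G1 of MEMO-desc v1.0 for the optimal lattice (no Manin constant enters:
`ratPlusSymbol` is normalised by `Λ_f` itself). Sources: Manin 1972 Cor. 3.6; MTT86 §I.8;
Cremona §2.8. -/
@[conjecture] def SymbolTwoIntegralityAtTwo : Prop :=
  ∀ (W : WeierstrassCurve ℚ) [W.IsElliptic] [W.IsGloballyMinimal], GoodSS W 2 →
  ∀ [NeZero (W.conductorNorm ℤ)] (f : CuspForm (Gamma0 (W.conductorNorm ℤ)) 2), IsNewformOf W f →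
  ∀ (S : Finset ℕ), (∀ ℓ ∈ S, ℓ.Prime ∧ Odd ℓ) → ∀ (m : ℕ) (a : ℤ),
    IsTwoIntegral (2 * depleteSymbolOver W S (ratPlusSymbol f) ((a : ℚ) / 2 ^ m)) ∧
      IsTwoIntegral (2 * depleteSymbolOver W S (ratMinusSymbol f) ((a : ℚ) / 2 ^ m))

/-- **Support (conjectural `μ = 0` for the `E[2]`-valued element; census target) — SHADOWS DO NOT ALL
VANISH.** For `Δ_W > 0` (where the two parities are the full coordinates of `Ξ^S(r) ∈ E_f[2]`), good
supersingular `2`, and any finite set `S` of odd primes: some doubled depleted symbol at a `2`-power cusp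
is odd. Equivalently the `E[2]`-valued depleted Mazur–Tate tower is not identically `0 mod 2`. Why it
might fail: it is a `μ = 0` statement at `p = 2` (no theorem in print; the `Λ`-adic Euler factors have
`μ = 0`, so depletion is not the danger — the undepleted element is). -/
@[conjecture] def ShadowMuZeroAtTwo : Prop :=
  ∀ (W : WeierstrassCurve ℚ) [W.IsElliptic] [W.IsGloballyMinimal], GoodSS W 2 → 0 < W.Δ →
  ∀ [NeZero (W.conductorNorm ℤ)] (f : CuspForm (Gamma0 (W.conductorNorm ℤ)) 2), IsNewformOf W f →
  ∀ (S : Finset ℕ), (∀ ℓ ∈ S, ℓ.Prime ∧ Odd ℓ) →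
    ∃ (m : ℕ) (a : ℤ), plusShadow W f S ((a : ℚ) / 2 ^ m) ≠ 0 ∨ minusShadow W f S ((a : ℚ) / 2 ^ m) ≠ 0

/-- **CRUX (rank 2) — PENCIL TRANSPORT AT `2`.** Two globally minimal elliptic curves over `ℚ`, good
supersingular at `2`, positive discriminants, `ℚ(E₁[2])` an `S₃`-field (`Δ₁` not a square, so the
`G_ℚ`-isomorphism `E₁[2] ≅ E₂[2]` is unique), `2`-congruent through a root map `q`; newforms `f₁, f₂`;
`S` any finite set of odd primes containing the primes of `N₁N₂`; both `E[2]`-valued depleted elements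
not identically zero mod `2`. THEN for every real root `θ` of `ψ₁` and every `2`-power cusp `a/2^m`
the line shadow of `f₁` on `θ` equals the line shadow of `f₂` on `q(θ)`:
`e₂(Ξ₁^S(r), T) = e₂(Ξ₂^S(r), φT)`, i.e. `φ(Ξ₁^S) = Ξ₂^S` coefficientwise. Mechanism (Vatsal 1999 at
`p = 2` with `Λ/2Λ ≅ E[2]` replacing the `±`-parts): both depleted forms are `𝕋(M)`-eigenforms with the
same eigencharacter mod `𝔪` (`char 2`, non-Eisenstein since `ρ̄` is irreducible); the maps
`J₀(M)[2] → Eᵢ[2]` they induce are `G_ℚ × 𝕋`-equivariant and factor through `J₀(M)[2]/𝔪`; if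
MULTIPLICITY ONE holds there (`dim_{𝔽₂} J₀(M)[𝔪] = 2`; `ρ̄|_{G_{ℚ₂}}` is irreducible with inertia of
order `3` at a supersingular `2`, the case NOT covered by the Kilford–Wiese failures) both are
isomorphisms and differ by the unique `φ`; the relative cycle `{∞,0}` is handled by
`(ℤ[cusps]⁰)_𝔪 = 0`. Why it might fail: multiplicity one / Gorenstein for `𝕋(M)_𝔪` in residue
characteristic `2` at the NON-MINIMAL odd level `M ∋ ℓ²` is not in print and is false in neighbouring
cases (Kilford 2002, Kilford–Wiese 2008: `Γ₀(N)`, `ρ̄` unramified at `2` with scalar Frobenius).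
Sources: Vatsal 1999 (Duke 98) Thm. 1.10/§3; Greenberg–Vatsal 2000; Buzzard 2000 (mult. one mod 2);
Edixhoven 1992 Thm. 9.2; Emerton–Pollack–Weston 2006 §3. Cheapest falsifier: ENGINE D2 table — any
accidental mod-2 congruence between two `Δ > 0` good-ss-at-2 curves with `N ≤ 2·10⁴` whose shadow
bit-vectors disagree after the root map. -/
@[conjecture] def PencilTransportAtTwo : Prop :=
  ∀ (W₁ W₂ : WeierstrassCurve ℚ) [W₁.IsElliptic] [W₁.IsGloballyMinimal] [W₂.IsElliptic]
    [W₂.IsGloballyMinimal], GoodSS W₁ 2 → GoodSS W₂ 2 → 0 < W₁.Δ → 0 < W₂.Δ → ¬ IsSquare W₁.Δ →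
  ∀ (q₀ q₁ q₂ : ℚ), IsRootMap W₁ W₂ q₀ q₁ q₂ →
  ∀ [NeZero (W₁.conductorNorm ℤ)] [NeZero (W₂.conductorNorm ℤ)]
    (f₁ : CuspForm (Gamma0 (W₁.conductorNorm ℤ)) 2) (f₂ : CuspForm (Gamma0 (W₂.conductorNorm ℤ)) 2),
    IsNewformOf W₁ f₁ → IsNewformOf W₂ f₂ →
  ∀ (S : Finset ℕ), (∀ ℓ ∈ S, ℓ.Prime ∧ Odd ℓ) →
    (W₁.conductorNorm ℤ * W₂.conductorNorm ℤ).primeFactors ⊆ S →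
    (∃ (m : ℕ) (a : ℤ), plusShadow W₁ f₁ S ((a : ℚ) / 2 ^ m) ≠ 0 ∨ minusShadow W₁ f₁ S ((a : ℚ) / 2 ^ m) ≠ 0) →
    (∃ (m : ℕ) (a : ℤ), plusShadow W₂ f₂ S ((a : ℚ) / 2 ^ m) ≠ 0 ∨ minusShadow W₂ f₂ S ((a : ℚ) / 2 ^ m) ≠ 0) →
  ∀ (θ : ℝ), IsRealTwoDivRoot W₁ θ → ∀ (m : ℕ) (a : ℤ),
    lineShadow W₁ f₁ S ((a : ℚ) / 2 ^ m) θ =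
      lineShadow W₂ f₂ S ((a : ℚ) / 2 ^ m) ((q₀ : ℝ) + q₁ * θ + q₂ * θ ^ 2)

/-- **Target (forced by the crux + pencil algebra) — THREE-LINE LAYER LAW AT `2`, symbol level.**
Three curves of a positive-discriminant mod-2 packet (root maps out of `W₁`, `S₃` division field),
newforms, `S ⊇` primes of `N₁N₂N₃` odd, each `E[2]`-valued depleted element nonzero mod 2, realising
three DISTINCT real lines in `W₁`'s frame (`θ₁` least root of `ψ₁`, `θ₂, θ₃` the block roots of `W₂, W₃`,
pairwise distinct): at EVERY layer `n` the `T`-orders of the three plus-shadow layer elements (each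
curve on its OWN Kummer line) are isosceles-or-degenerate. By `PencilTransportAtTwo` the three elements
are `{A_n, B_n, A_n + B_n} ⊂ 𝔽₂[T]`, and the shape is the pencil lemma. No scalar `tᵢ`, no Sprung pair,
no `♯/♭` choice enters (answers REF1 §4 on DESC-A: the normalisation is the lattice `Λ_{fᵢ}` itself);
the bridge to `λ♯/λ♭` (`ord_T S_n − q_n`-type shifts by parity of `n`) is Sprung 2017 / Pollack 2003 and
stays in DESC-A. Census (g0, X5 table): 3-block packets 10527d1, 117747d1 layerwise 10/10, within-block
constancy 23/23. -/
@[conjecture] def ThreeLineLayerLawAtTwo : Prop :=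
  ∀ (W₁ W₂ W₃ : WeierstrassCurve ℚ) [W₁.IsElliptic] [W₁.IsGloballyMinimal] [W₂.IsElliptic]
    [W₂.IsGloballyMinimal] [W₃.IsElliptic] [W₃.IsGloballyMinimal],
    GoodSS W₁ 2 → GoodSS W₂ 2 → GoodSS W₃ 2 → 0 < W₁.Δ → 0 < W₂.Δ → 0 < W₃.Δ → ¬ IsSquare W₁.Δ →
  ∀ (q₀ q₁ q₂ r₀ r₁ r₂ : ℚ), IsRootMap W₁ W₂ q₀ q₁ q₂ → IsRootMap W₁ W₃ r₀ r₁ r₂ →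
  ∀ (θ₁ θ₂ θ₃ : ℝ), IsLeastRealTwoDivRoot W₁ θ₁ → IsBlockRoot W₁ W₂ q₀ q₁ q₂ θ₂ →
    IsBlockRoot W₁ W₃ r₀ r₁ r₂ θ₃ → θ₁ ≠ θ₂ → θ₁ ≠ θ₃ → θ₂ ≠ θ₃ →
  ∀ [NeZero (W₁.conductorNorm ℤ)] [NeZero (W₂.conductorNorm ℤ)] [NeZero (W₃.conductorNorm ℤ)]
    (f₁ : CuspForm (Gamma0 (W₁.conductorNorm ℤ)) 2) (f₂ : CuspForm (Gamma0 (W₂.conductorNorm ℤ)) 2)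
    (f₃ : CuspForm (Gamma0 (W₃.conductorNorm ℤ)) 2),
    IsNewformOf W₁ f₁ → IsNewformOf W₂ f₂ → IsNewformOf W₃ f₃ →
  ∀ (S : Finset ℕ), (∀ ℓ ∈ S, ℓ.Prime ∧ Odd ℓ) →
    (W₁.conductorNorm ℤ * W₂.conductorNorm ℤ * W₃.conductorNorm ℤ).primeFactors ⊆ S →
    (∃ (m : ℕ) (a : ℤ), plusShadow W₁ f₁ S ((a : ℚ) / 2 ^ m) ≠ 0 ∨ minusShadow W₁ f₁ S ((a : ℚ) / 2 ^ m) ≠ 0) →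
    (∃ (m : ℕ) (a : ℤ), plusShadow W₂ f₂ S ((a : ℚ) / 2 ^ m) ≠ 0 ∨ minusShadow W₂ f₂ S ((a : ℚ) / 2 ^ m) ≠ 0) →
    (∃ (m : ℕ) (a : ℤ), plusShadow W₃ f₃ S ((a : ℚ) / 2 ^ m) ≠ 0 ∨ minusShadow W₃ f₃ S ((a : ℚ) / 2 ^ m) ≠ 0) →
  ∀ n : ℕ, IsIsoscelesTop (layerOrder (plusShadow W₁ f₁ S) n) (layerOrder (plusShadow W₂ f₂ S) n)
    (layerOrder (plusShadow W₃ f₃ S) n)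

/-- **PENCIL LEMMA over `𝔽₂[T]` (the "forced algebra"; support, provable in a few lines from
`Polynomial.trailingDegree` ultrametricity and `1 + 1 = 0`).** -/
@[conjecture] def PencilLemma : Prop :=
  ∀ A B : Polynomial (ZMod 2), IsIsoscelesTop A.trailingDegree B.trailingDegree (A + B).trailingDegree

/-- **Candidate B v1.1 (algebraic) — ISOSCELES LAW FOR SIGNED SELMER DUALS AT `2`, with REF1's hidden
hypothesis `(H_fin)` explicit:** each dual `Dᵢ.X` has NO nonzero finite `Λ`-submodule (an element killed
by a power of `2` and a power of `T` is zero). `(H_res)` — perfect control / exactness of restriction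
along the tower for the signed conditions at `2` — stays a docstring assumption: it is part of what
"`Dᵢ` is the signed Selmer dual of `Wᵢ`" must mean and is carried by `SignedSelmerDualData`'s own
specification, not re-typed here. Otherwise verbatim DESC-B (g0). -/
@[conjecture] def IsoscelesLawSignedSelmerAtTwoFG : Prop :=
  ∀ (W₁ W₂ W₃ : WeierstrassCurve ℚ) [W₁.IsElliptic] [W₁.IsGloballyMinimal] [W₂.IsElliptic]
    [W₂.IsGloballyMinimal] [W₃.IsElliptic] [W₃.IsGloballyMinimal],
    GoodSS W₁ 2 → GoodSS W₂ 2 → GoodSS W₃ 2 →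
    W₁.frobeniusTrace 2 = 0 → W₂.frobeniusTrace 2 = 0 → W₃.frobeniusTrace 2 = 0 →
    0 < W₁.Δ → 0 < W₂.Δ → 0 < W₃.Δ →
  ∀ (q₀ q₁ q₂ r₀ r₁ r₂ : ℚ), IsRootMap W₁ W₂ q₀ q₁ q₂ → IsRootMap W₁ W₃ r₀ r₁ r₂ →
  ∀ (θ₁ θ₂ θ₃ : ℝ), IsLeastRealTwoDivRoot W₁ θ₁ → IsBlockRoot W₁ W₂ q₀ q₁ q₂ θ₂ →
    IsBlockRoot W₁ W₃ r₀ r₁ r₂ θ₃ → θ₁ ≠ θ₂ → θ₁ ≠ θ₃ → θ₂ ≠ θ₃ →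
  ∀ (κ : ZpExtension ℚ 2) (γ : Field.absoluteGaloisGroup ℚ), κ.IsCyclotomic → κ.IsTopGenerator γ →
  ∀ (ε : ℤˣ) (D₁ : Kobayashi2003.SignedSelmerDualData W₁ κ γ ε)
    (D₂ : Kobayashi2003.SignedSelmerDualData W₂ κ γ ε) (D₃ : Kobayashi2003.SignedSelmerDualData W₃ κ γ ε),
    Module.Finite (IwasawaAlgebra 2) D₁.X → Module.Finite (IwasawaAlgebra 2) D₂.X →
    Module.Finite (IwasawaAlgebra 2) D₃.X →
    Module.IsTorsion (IwasawaAlgebra 2) D₁.X → Module.IsTorsion (IwasawaAlgebra 2) D₂.X →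
    Module.IsTorsion (IwasawaAlgebra 2) D₃.X → D₁.mu = 0 → D₂.mu = 0 → D₃.mu = 0 →
    (∀ x : D₁.X, (∃ k : ℕ, (2 : IwasawaAlgebra 2) ^ k • x = 0 ∧ (PowerSeries.X : IwasawaAlgebra 2) ^ k • x = 0) → x = 0) →
    (∀ x : D₂.X, (∃ k : ℕ, (2 : IwasawaAlgebra 2) ^ k • x = 0 ∧ (PowerSeries.X : IwasawaAlgebra 2) ^ k • x = 0) → x = 0) →
    (∀ x : D₃.X, (∃ k : ℕ, (2 : IwasawaAlgebra 2) ^ k • x = 0 ∧ (PowerSeries.X : IwasawaAlgebra 2) ^ k • x = 0) → x = 0) →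
  IsIsosceles
    (D₁.lambda + matsunoSigmaShiftAtTwo W₁ (W₁.conductorNorm ℤ * W₂.conductorNorm ℤ * W₃.conductorNorm ℤ).primeFactors)
    (D₂.lambda + matsunoSigmaShiftAtTwo W₂ (W₁.conductorNorm ℤ * W₂.conductorNorm ℤ * W₃.conductorNorm ℤ).primeFactors)
    (D₃.lambda + matsunoSigmaShiftAtTwo W₃ (W₁.conductorNorm ℤ * W₂.conductorNorm ℤ * W₃.conductorNorm ℤ).primeFactors)

end Summit.BirchSwinnertonDyer.Rank1Residual.F1Sign2

end
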